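import Summits.QuantumFields.YangMills.Theorems.BalabanUVNodesN15TwoSpacingGluingAdjointLocalGauges
import Summits.QuantumFields.YangMills.Theorems.BalabanUVNodesN15CurvedGluingLocalGaugesTwoGrid
import HarnessLib

/-!
# THE ADJOINT GLUING ACROSS PER-CUBE GAUGES, TWO GRIDS (dag-n15-w2 `…CurvedGluingLocalGaugesTwoGrid` transposed): FILE 158's two-spacing η-defect of entry 2 for the conjugated-back
# families, fine cubes in the PULLED-BACK gauges `W_k∘π`, every per-cube row ∕ defect given IN THE CUBES' GAUGES (dag-n15-c g18, FILE 161; N15 = NE2, s1 «background-layer OPERATOR ingredient»)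

Cell `pub-ymgap`, seat `pub-ymgap-dag-n15-c` (R134 (a); HUMAN RULING D-0062), generation 18.  `bears_on: R4∕N15 · K3⁸ SpineGivenEndpointR13SepCoPHV (stmt-QuantumFields-27366)`.
Filed `--kind proof --supports stmt-QuantumFields-27366 --as helper` — COUNT-NEUTRAL.  Theorems only; 0 `def`, 0 `sorry`.  Imports BY NAME FILE 160 `…TwoSpacingGluingAdjointLocalGauges` (one-grid
transfers, at both grids) and dag-n15-w2 `…CurvedGluingLocalGaugesTwoGrid` (`cutDefect_of_localGauge`; through it dag-n15-w3 `hasMaj_idef_gaugeConj_of_pullback`, `comp_commOp_gaugeConj`,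
`transpose_gaugeConj_cancel`, `entry_le_one_of_orthogonal`, `transpose_entry_le_one_of_orthogonal`); FILE 158 `hasMaj_idef_glueInvL_parametrix_comp_cut_of_defect_out`.  Nothing restated.

WHY.  The two-grid twin of FILE 160: [B9] Thm 3.14's difference of entry 2 at two spacings, each cube computed in its own gauge, the fine cube in the pulled-back gauge `W_k∘π` (dag-n15-w3
`hasMaj_idef_gaugeConj_of_pullback`: no gauge-fit term).  The adjoint-side defect families — `𝔇(G″∘[Δ′^{W∘π}, M_{h′}], G′∘[Δ^W, M_h])` OUTPUT-localized, the sandwiched operators' and the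
right-locality defects' defects two-sided — transfer with `|κ|²`; then FILE 158 ★★★.

WHAT.  §1 `commDefectR_of_localGauge`, `conjDefect₂_of_localGauge`; §2 ★★★ `hasMaj_idef_gluedL_comp_of_localGauges` (FILE 158 ★★★'s bound with every cube letter `× |κ|²`).

HONEST FRAMING ∕ LIMITS.  Conjugation algebra + block-majorant bookkeeping over DISPLAYED letters at both grids; proves NO estimate of any concrete propagator; nothing of [B5]∕[B6]∕[B9] asserted
((3.34)–(3.35) p.396, (3.42) p.397, (3.87) p.409, (2.91)–(2.93) p.239, (2.133)–(2.136) p.247 = SHAPES; Thm 3.14 pp.426–427 = difference TEMPLATE).  NE2⁺ NOT PRINTED, NOT proved; N15 NOT discharged;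
K3⁸ OPEN, skeleton v7 untouched (0∕2); counts of record UNMOVED by this seat (typed 28∕28 · discharged 7∕28 = 7∕27 excl. NODE O, №245); one finite 𝕋⁴ at fixed ε — NOT infinite volume, NOT OS on ℝ⁴,
NOT a mass gap, NOT Clay; R4 closes the conditional finite-𝕋⁴ rung `BalabanLadder.UV` only.  Restate-immune (no Theses import).
-/

set_option autoImplicit false

noncomputable section
open scoped BigOperators Matrix
open Finset

namespace Summit.QuantumFields.YangMills.BalabanUVNodes.N15.Gluing

open Literature.MathematicalPhysics.QuantumFieldTheory.Balaban1983to89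
open Literature.MathematicalPhysics.QuantumFieldTheory.Balaban1983to89.B11SectG (BlockNorm HasMaj RowSum)
open Literature.MathematicalPhysics.QuantumFieldTheory.Balaban1983to89.B6RandomWalk (Triangle254)
open Literature.MathematicalPhysics.QuantumFieldTheory.Balaban1983to89.B6Prop26Gluing (mulOp ind ind_nonneg)
open Literature.MathematicalPhysics.QuantumFieldTheory.Balaban1983to89.T4EtaRateDefect (idef)
open Literature.MathematicalPhysics.QuantumFieldTheory.Balaban1983to89.T4EtaRateCoeffDefect (pull)
open Summit.QuantumFields.YangMills.BalabanUVNodes.N15.MatrixSpecies (mmulOp liftBlk liftMap)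
open Summit.QuantumFields.YangMills.BalabanUVNodes.N15.CurvedSpecies (cutRow_of_localGauge cutDefect_of_localGauge localOp_conj_back comp_commOp_gaugeConj transpose_gaugeConj_cancel
  hasMaj_idef_gaugeConj_of_pullback entry_le_one_of_orthogonal transpose_entry_le_one_of_orthogonal)

variable {X X' : Type} [Fintype X] [Fintype X'] [DecidableEq X] [DecidableEq X'] {κ : Type} [Fintype κ] [DecidableEq κ] {K : Type} [Fintype K] {g : B6.Geometry}
  (blk : X → g.Site) (π : X' → X) (S : K → Set g.Site) (W : K → X → Matrix κ κ ℝ)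
  (Δ E : (X × κ → ℝ) →ₗ[ℝ] (X × κ → ℝ)) (Δ' Ef : (X' × κ → ℝ) →ₗ[ℝ] (X' × κ → ℝ)) (hX χX hs : K → X → ℝ) (hX' χX' hs' : K → X' → ℝ)
  (G' T' E' : K → (X × κ → ℝ) →ₗ[ℝ] (X × κ → ℝ)) (G'' T'' E'' : K → (X' × κ → ℝ) →ₗ[ℝ] (X' × κ → ℝ))

/-! ## §1 The adjoint-side η-defect families transfer in the pulled-back gauge -/

section Rows

omit [DecidableEq X] [DecidableEq X'] [Fintype K] in
/-- ★★ **ADJOINT COMMUTATOR DEFECTS TRANSFER**: the LOCAL defect `𝔇(G″∘[Δ′^{W∘π}, M_{h′}], G′∘[Δ^W, M_h]) ≤ 1_S(y)·re^{−δd}` (output-localized) ⟹ the same for the conjugated-back pair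
`𝔇((M_{(W∘π)ᵀ}G″M_{W∘π})∘[Δ′, M_{h′}], (M_{Wᵀ}G′M_W)∘[Δ, M_h])` with `|κ|²r` (dag-n15-w3 `comp_commOp_gaugeConj` + `hasMaj_idef_gaugeConj_of_pullback`).
[cite: Balaban1984PropagatorsII, (2.93) p.239 (shape, transposed); Balaban1985BackgroundPropagators, (3.34) p.396, Thm 3.14 pp.426–427] -/
theorem commDefectR_of_localGauge (hW : ∀ k x, W k x * (W k x)ᵀ = 1) (hW' : ∀ k x, (W k x)ᵀ * W k x = 1) {r δ : ℝ} (hr : 0 ≤ r) (k : K)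
    (hD : HasMaj (BlockNorm.ofBlocks g (liftBlk blk κ)) (BlockNorm.ofBlocks g (liftBlk (blk ∘ π) κ))
      (idef (pull (liftMap π κ)) (pull (liftMap π κ)) (G'' k ∘ₗ commOp (mmulOp (fun x' => W k (π x')) ∘ₗ Δ' ∘ₗ mmulOp (fun x' => (W k (π x'))ᵀ)) (fun p : X' × κ => hX' k p.1)) (G' k ∘ₗ commOp (mmulOp (W k) ∘ₗ Δ ∘ₗ mmulOp (fun x => (W k x)ᵀ)) (fun p : X × κ => hX k p.1))) (fun y y' => ind (S k) y * (r * Real.exp (-(δ * g.dist y y'))))) :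
    HasMaj (BlockNorm.ofBlocks g (liftBlk blk κ)) (BlockNorm.ofBlocks g (liftBlk (blk ∘ π) κ))
      (idef (pull (liftMap π κ)) (pull (liftMap π κ)) ((mmulOp (fun x' => (W k (π x'))ᵀ) ∘ₗ G'' k ∘ₗ mmulOp (fun x' => W k (π x'))) ∘ₗ commOp Δ' (fun p : X' × κ => hX' k p.1)) ((mmulOp (fun x => (W k x)ᵀ) ∘ₗ G' k ∘ₗ mmulOp (W k)) ∘ₗ commOp Δ (fun p : X × κ => hX k p.1)))
      (fun y y' => ind (S k) y * ((Fintype.card κ : ℝ) ^ 2 * r * Real.exp (-(δ * g.dist y y')))) := by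
  have hV' : ∀ x, ((W k x)ᵀ)ᵀ * (W k x)ᵀ = 1 := fun x => by rw [Matrix.transpose_transpose]; exact hW k x
  have hVπ' : ∀ x', ((W k (π x'))ᵀ)ᵀ * (W k (π x'))ᵀ = 1 := fun x' => hV' (π x')
  have e := comp_commOp_gaugeConj (fun x => (W k x)ᵀ) hV' (hX k) (mmulOp (W k) ∘ₗ Δ ∘ₗ mmulOp (fun x => (W k x)ᵀ)) (G' k)
  have e' := comp_commOp_gaugeConj (fun x' => (W k (π x'))ᵀ) hVπ' (hX' k) (mmulOp (fun x' => W k (π x')) ∘ₗ Δ' ∘ₗ mmulOp (fun x' => (W k (π x'))ᵀ)) (G'' k)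
  simp only [Matrix.transpose_transpose] at e e'
  rw [show (fun x => W k x) = W k from rfl, localOp_conj_back W Δ hW' k] at e
  rw [transpose_gaugeConj_cancel (fun x' => W k (π x')) (fun x' => hW' k (π x')) Δ'] at e'
  rw [e, e']
  have h := hasMaj_idef_gaugeConj_of_pullback π (fun x => (W k x)ᵀ) blk (fun y y' => ?_) (transpose_entry_le_one_of_orthogonal (hW' k))
    (fun x i j => by rw [Matrix.transpose_transpose]; exact entry_le_one_of_orthogonal (hW k) x i j) hD
  · simp only [Matrix.transpose_transpose] at h
    rw [show (fun x => W k x) = W k from rfl] at h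
    exact h.mono fun y y' => le_of_eq (by ring)
  · exact mul_nonneg (ind_nonneg _ y) (mul_nonneg hr (Real.exp_nonneg _))

omit [DecidableEq X] [DecidableEq X'] [Fintype K] in
/-- ★ **TWO-SIDED DEFECTS TRANSFER** (the sandwiched operators' `𝔇(T″, T′)` and the right-locality defects' `𝔇(Ẽ″, Ẽ′)`): `𝔇(T″, T′) ≤ 1_S1_S·me^{−δd}` ⟹ `𝔇(M_{(W∘π)ᵀ}T″M_{W∘π}, M_{Wᵀ}T′M_W) ≤ 1_S1_S·|κ|²m·e^{−δd}`.
[cite: Balaban1985BackgroundPropagators, (3.34)–(3.35) p.396, Thm 3.14 pp.426–427 (shapes)] -/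
theorem conjDefect₂_of_localGauge (hW : ∀ k x, W k x * (W k x)ᵀ = 1) (hW' : ∀ k x, (W k x)ᵀ * W k x = 1) {m δ : ℝ} (hm : 0 ≤ m) (k : K) {T₁ : K → (X × κ → ℝ) →ₗ[ℝ] (X × κ → ℝ)}
    {T₂ : K → (X' × κ → ℝ) →ₗ[ℝ] (X' × κ → ℝ)} (hD : HasMaj (BlockNorm.ofBlocks g (liftBlk blk κ)) (BlockNorm.ofBlocks g (liftBlk (blk ∘ π) κ)) (idef (pull (liftMap π κ)) (pull (liftMap π κ)) (T₂ k) (T₁ k)) (fun y y' => ind (S k) y * ind (S k) y' * (m * Real.exp (-(δ * g.dist y y'))))) :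
    HasMaj (BlockNorm.ofBlocks g (liftBlk blk κ)) (BlockNorm.ofBlocks g (liftBlk (blk ∘ π) κ))
      (idef (pull (liftMap π κ)) (pull (liftMap π κ)) (mmulOp (fun x' => (W k (π x'))ᵀ) ∘ₗ T₂ k ∘ₗ mmulOp (fun x' => W k (π x'))) (mmulOp (fun x => (W k x)ᵀ) ∘ₗ T₁ k ∘ₗ mmulOp (W k)))
      (fun y y' => ind (S k) y * ind (S k) y' * ((Fintype.card κ : ℝ) ^ 2 * m * Real.exp (-(δ * g.dist y y')))) := by
  have h := hasMaj_idef_gaugeConj_of_pullback π (fun x => (W k x)ᵀ) blk (fun y y' => ?_) (transpose_entry_le_one_of_orthogonal (hW' k))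
    (fun x i j => by rw [Matrix.transpose_transpose]; exact entry_le_one_of_orthogonal (hW k) x i j) hD
  · simp only [Matrix.transpose_transpose] at h
    rw [show (fun x => W k x) = W k from rfl] at h
    exact h.mono fun y y' => le_of_eq (by ring)
  · exact mul_nonneg (mul_nonneg (ind_nonneg _ y) (ind_nonneg _ y')) (mul_nonneg hm (Real.exp_nonneg _))

end Rows

/-! ## §2 FILE 158's two-spacing η-defect with the cubes given in their own gauges -/

section Glue

variable {σ cr : ℝ}

/-- ★★★ **THE TWO-SPACING η-DEFECT OF ENTRY 2 OF THE ADJOINT GLUED OPERATOR BUILT FROM PER-CUBE-GAUGE CUBES** — FILE 158 `hasMaj_idef_glueInvL_parametrix_comp_cut_of_defect_out` for the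
conjugated-back families (coarse gauge `W_k`, fine gauge `W_k∘π`), every per-cube datum IN THE CUBES' GAUGES at both grids: cut rows `β`, sandwiches against `E^{W_k}`, `E′^{W_k∘π}` with rows `β₂`,
OUTPUT-localized adjoint commutator rows `θ₀`, two-sided right-locality defect rows `ε`; the local two-grid defects `m₀` (cut rows), `m₂` (sandwiched operators), `r` (adjoint commutator rows, output-localized),
`r_E` (defect rows); the GLOBAL right entries' scalar adjoint Leibniz rules at both grids and the partition fits `o, o_s, o_d`; overlap; `2σ ≤ δ`; `N_ov(|κ|²θ₀ + |κ|²ε)c_r < 1` ⟹ FILE 158 ★★★'s bound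
with every cube letter multiplied by `|κ|²`. [cite: Balaban1985BackgroundPropagators, Thm 3.14 pp.426–427 (difference template), (3.34)–(3.35) p.396, (3.42) p.397, (3.87) p.409; Balaban1984PropagatorsII, (2.91)–(2.93) p.239, (2.133)–(2.136) p.247] -/
theorem hasMaj_idef_gluedL_comp_of_localGauges (htri : Triangle254 g) (hd : ∀ a b : g.Site, 0 ≤ g.dist a b) (hd0 : ∀ y : g.Site, g.dist y y = 0) (hrow : RowSum g σ cr) (hσ : 0 ≤ σ)
    (hcr : 0 ≤ cr) (hW : ∀ k x, W k x * (W k x)ᵀ = 1) (hW' : ∀ k x, (W k x)ᵀ * W k x = 1) {dh : K → X → ℝ} {dh' : K → X' → ℝ}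
    {β β₂ cs cd o os od m₀ m₂ θ₀ ε r rE δ Nov : ℝ} (hβ : 0 ≤ β) (hβ₂ : 0 ≤ β₂) (hcs : 0 ≤ cs) (hcd : 0 ≤ cd) (ho : 0 ≤ o) (hos : 0 ≤ os) (hod : 0 ≤ od) (hm₀ : 0 ≤ m₀) (hm₂ : 0 ≤ m₂)
    (hθ : 0 ≤ θ₀) (hε : 0 ≤ ε) (hr : 0 ≤ r) (hrE : 0 ≤ rE) (hNov : 0 ≤ Nov) (hσδ : 2 * σ ≤ δ)
    (hleib : ∀ k, mulOp (fun p : X × κ => hX k p.1) ∘ₗ E = E ∘ₗ mulOp (fun p : X × κ => hs k p.1) + mulOp (fun p : X × κ => dh k p.1))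
    (hleib' : ∀ k, mulOp (fun p : X' × κ => hX' k p.1) ∘ₗ Ef = Ef ∘ₗ mulOp (fun p : X' × κ => hs' k p.1) + mulOp (fun p : X' × κ => dh' k p.1))
    (hcut : ∀ k, mulOp (fun p : X × κ => hX k p.1) ∘ₗ mulOp (fun p : X × κ => χX k p.1) = mulOp (fun p : X × κ => hX k p.1))
    (hcut' : ∀ k, mulOp (fun p : X' × κ => hX' k p.1) ∘ₗ mulOp (fun p : X' × κ => χX' k p.1) = mulOp (fun p : X' × κ => hX' k p.1))
    (hE2' : ∀ k, mulOp (fun p : X × κ => χX k p.1) ∘ₗ G' k ∘ₗ (mmulOp (W k) ∘ₗ E ∘ₗ mmulOp (fun x => (W k x)ᵀ)) ∘ₗ mulOp (fun p : X × κ => hs k p.1) = T' k ∘ₗ mulOp (fun p : X × κ => hs k p.1))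
    (hE2'' : ∀ k, mulOp (fun p : X' × κ => χX' k p.1) ∘ₗ G'' k ∘ₗ (mmulOp (fun x' => W k (π x')) ∘ₗ Ef ∘ₗ mmulOp (fun x' => (W k (π x'))ᵀ)) ∘ₗ mulOp (fun p : X' × κ => hs' k p.1) = T'' k ∘ₗ mulOp (fun p : X' × κ => hs' k p.1))
    (hh : ∀ k x, |hX k x| ≤ 1) (hh' : ∀ k x', |hX' k x'| ≤ 1) (hhs : ∀ k x, |hs k x| ≤ cs) (hdh : ∀ k x, |dh k x| ≤ cd)
    (hfit : ∀ k x', |hX' k x' - hX k (π x')| ≤ o) (hfits : ∀ k x', |hs' k x' - hs k (π x')| ≤ os) (hfitd : ∀ k x', |dh' k x' - dh k (π x')| ≤ od) (hN : ∀ b, ∑ k, ind (S k) b ≤ Nov)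
    (hGc' : ∀ k, HasMaj (BlockNorm.ofBlocks g (liftBlk blk κ)) (BlockNorm.ofBlocks g (liftBlk blk κ)) (mulOp (fun p : X × κ => χX k p.1) ∘ₗ G' k) (fun y y' => ind (S k) y * ind (S k) y' * (β * Real.exp (-(δ * g.dist y y')))))
    (hGc'' : ∀ k, HasMaj (BlockNorm.ofBlocks g (liftBlk (blk ∘ π) κ)) (BlockNorm.ofBlocks g (liftBlk (blk ∘ π) κ)) (mulOp (fun p : X' × κ => χX' k p.1) ∘ₗ G'' k) (fun y y' => ind (S k) y * ind (S k) y' * (β * Real.exp (-(δ * g.dist y y')))))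
    (hT' : ∀ k, HasMaj (BlockNorm.ofBlocks g (liftBlk blk κ)) (BlockNorm.ofBlocks g (liftBlk blk κ)) (T' k) (fun y y' => ind (S k) y * ind (S k) y' * (β₂ * Real.exp (-(δ * g.dist y y')))))
    (hT'' : ∀ k, HasMaj (BlockNorm.ofBlocks g (liftBlk (blk ∘ π) κ)) (BlockNorm.ofBlocks g (liftBlk (blk ∘ π) κ)) (T'' k) (fun y y' => ind (S k) y * ind (S k) y' * (β₂ * Real.exp (-(δ * g.dist y y')))))
    (hIGc : ∀ k, HasMaj (BlockNorm.ofBlocks g (liftBlk blk κ)) (BlockNorm.ofBlocks g (liftBlk (blk ∘ π) κ)) (idef (pull (liftMap π κ)) (pull (liftMap π κ)) (mulOp (fun p : X' × κ => χX' k p.1) ∘ₗ G'' k) (mulOp (fun p : X × κ => χX k p.1) ∘ₗ G' k)) (fun y y' => ind (S k) y * ind (S k) y' * (m₀ * Real.exp (-(δ * g.dist y y')))))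
    (hIT : ∀ k, HasMaj (BlockNorm.ofBlocks g (liftBlk blk κ)) (BlockNorm.ofBlocks g (liftBlk (blk ∘ π) κ)) (idef (pull (liftMap π κ)) (pull (liftMap π κ)) (T'' k) (T' k)) (fun y y' => ind (S k) y * ind (S k) y' * (m₂ * Real.exp (-(δ * g.dist y y')))))
    (hK' : ∀ k, HasMaj (BlockNorm.ofBlocks g (liftBlk blk κ)) (BlockNorm.ofBlocks g (liftBlk blk κ)) (G' k ∘ₗ commOp (mmulOp (W k) ∘ₗ Δ ∘ₗ mmulOp (fun x => (W k x)ᵀ)) (fun p : X × κ => hX k p.1)) (fun y y' => ind (S k) y * (θ₀ * Real.exp (-(δ * g.dist y y')))))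
    (hK'' : ∀ k, HasMaj (BlockNorm.ofBlocks g (liftBlk (blk ∘ π) κ)) (BlockNorm.ofBlocks g (liftBlk (blk ∘ π) κ)) (G'' k ∘ₗ commOp (mmulOp (fun x' => W k (π x')) ∘ₗ Δ' ∘ₗ mmulOp (fun x' => (W k (π x'))ᵀ)) (fun p : X' × κ => hX' k p.1)) (fun y y' => ind (S k) y * (θ₀ * Real.exp (-(δ * g.dist y y')))))
    (hDK : ∀ k, HasMaj (BlockNorm.ofBlocks g (liftBlk blk κ)) (BlockNorm.ofBlocks g (liftBlk (blk ∘ π) κ))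
      (idef (pull (liftMap π κ)) (pull (liftMap π κ)) (G'' k ∘ₗ commOp (mmulOp (fun x' => W k (π x')) ∘ₗ Δ' ∘ₗ mmulOp (fun x' => (W k (π x'))ᵀ)) (fun p : X' × κ => hX' k p.1)) (G' k ∘ₗ commOp (mmulOp (W k) ∘ₗ Δ ∘ₗ mmulOp (fun x => (W k x)ᵀ)) (fun p : X × κ => hX k p.1))) (fun y y' => ind (S k) y * (r * Real.exp (-(δ * g.dist y y')))))
    (hEd' : ∀ k, HasMaj (BlockNorm.ofBlocks g (liftBlk blk κ)) (BlockNorm.ofBlocks g (liftBlk blk κ)) (E' k) (fun y y' => ind (S k) y * ind (S k) y' * (ε * Real.exp (-(δ * g.dist y y')))))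
    (hEd'' : ∀ k, HasMaj (BlockNorm.ofBlocks g (liftBlk (blk ∘ π) κ)) (BlockNorm.ofBlocks g (liftBlk (blk ∘ π) κ)) (E'' k) (fun y y' => ind (S k) y * ind (S k) y' * (ε * Real.exp (-(δ * g.dist y y')))))
    (hDEd : ∀ k, HasMaj (BlockNorm.ofBlocks g (liftBlk blk κ)) (BlockNorm.ofBlocks g (liftBlk (blk ∘ π) κ)) (idef (pull (liftMap π κ)) (pull (liftMap π κ)) (E'' k) (E' k)) (fun y y' => ind (S k) y * ind (S k) y' * (rE * Real.exp (-(δ * g.dist y y')))))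
    (hq : Nov * ((Fintype.card κ : ℝ) ^ 2 * θ₀ + (Fintype.card κ : ℝ) ^ 2 * ε) * cr < 1) :
    HasMaj (BlockNorm.ofBlocks g (liftBlk blk κ)) (BlockNorm.ofBlocks g (liftBlk (blk ∘ π) κ))
      (idef (pull (liftMap π κ)) (pull (liftMap π κ))
        (glueInvL (remainderL Δ' (fun k => fun p : X' × κ => hX' k p.1) (fun k => (mmulOp (fun x' => (W k (π x'))ᵀ) ∘ₗ G'' k ∘ₗ mmulOp (fun x' => W k (π x')))) - ∑ k, mulOp (fun p : X' × κ => hX' k p.1) ∘ₗ (mmulOp (fun x' => (W k (π x'))ᵀ) ∘ₗ E'' k ∘ₗ mmulOp (fun x' => W k (π x'))))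
          (parametrix (fun k => fun p : X' × κ => hX' k p.1) (fun k => (mmulOp (fun x' => (W k (π x'))ᵀ) ∘ₗ G'' k ∘ₗ mmulOp (fun x' => W k (π x'))))) ∘ₗ Ef)
        (glueInvL (remainderL Δ (fun k => fun p : X × κ => hX k p.1) (fun k => (mmulOp (fun x => (W k x)ᵀ) ∘ₗ G' k ∘ₗ mmulOp (W k))) - ∑ k, mulOp (fun p : X × κ => hX k p.1) ∘ₗ (mmulOp (fun x => (W k x)ᵀ) ∘ₗ E' k ∘ₗ mmulOp (W k)))
          (parametrix (fun k => fun p : X × κ => hX k p.1) (fun k => (mmulOp (fun x => (W k x)ᵀ) ∘ₗ G' k ∘ₗ mmulOp (W k)))) ∘ₗ E))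
      (fun y y' => (((1 - Nov * (((Fintype.card κ : ℝ) ^ 2 * θ₀) + ((Fintype.card κ : ℝ) ^ 2 * ε)) * cr)⁻¹ * (Nov * ((1 * ((Fintype.card κ : ℝ) ^ 2 * β₂) * os + 1 * ((Fintype.card κ : ℝ) ^ 2 * m₂) * cs + o * ((Fintype.card κ : ℝ) ^ 2 * β₂) * cs) + (1 * ((Fintype.card κ : ℝ) ^ 2 * β) * od + 1 * ((Fintype.card κ : ℝ) ^ 2 * m₀) * cd + o * ((Fintype.card κ : ℝ) ^ 2 * β) * cd))) * cr +
          (1 - Nov * (((Fintype.card κ : ℝ) ^ 2 * θ₀) + ((Fintype.card κ : ℝ) ^ 2 * ε)) * cr)⁻¹ * ((Nov * (((Fintype.card κ : ℝ) ^ 2 * r) + o * ((Fintype.card κ : ℝ) ^ 2 * θ₀) + (1 * ((Fintype.card κ : ℝ) ^ 2 * rE) + o * ((Fintype.card κ : ℝ) ^ 2 * ε)))) * ((1 - Nov * (((Fintype.card κ : ℝ) ^ 2 * θ₀) + ((Fintype.card κ : ℝ) ^ 2 * ε)) * cr)⁻¹ * (Nov * (((Fintype.card κ : ℝ) ^ 2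 * β₂) * cs + ((Fintype.card κ : ℝ) ^ 2 * β) * cd)) * cr) * cr) * cr)) *
        Real.exp (-((δ - 2 * σ) * g.dist y y'))) := by
  have hWπ : ∀ k x', W k (π x') * (W k (π x'))ᵀ = 1 := fun k x' => hW k (π x')
  have hWπ' : ∀ k x', (W k (π x'))ᵀ * W k (π x') = 1 := fun k x' => hW' k (π x')
  exact hasMaj_idef_glueInvL_parametrix_comp_cut_of_defect_out (liftBlk blk κ) (liftMap π κ) S htri hd hd0 hrow hσ hcr (by positivity) (by positivity) hcs hcd ho hos hod (by positivity)
    (by positivity) (by positivity) (by positivity) (by positivity) (by positivity) hNov hσδ hleib hleib' hcut hcut'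
    (fun k => sandwichR_of_localGauge W E χX hs G' T' hW' k (hE2' k))
    (fun k => sandwichR_of_localGauge (fun k x' => W k (π x')) Ef χX' hs' G'' T'' hWπ' k (hE2'' k))
    (fun k p => hh k p.1) (fun k p => hh' k p.1) (fun k p => hhs k p.1) (fun k p => hdh k p.1) (fun k p => hfit k p.1) (fun k p => hfits k p.1) (fun k p => hfitd k p.1) hN
    (fun k => cutRow_of_localGauge blk S W χX G' hW hW' hβ k (hGc' k)) (fun k => cutRow_of_localGauge (blk ∘ π) S (fun k x' => W k (π x')) χX' G'' hWπ hWπ' hβ k (hGc'' k))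
    (fun k => sandwichRow_of_localGauge blk S W T' hW hW' hβ₂ k (hT' k)) (fun k => sandwichRow_of_localGauge (blk ∘ π) S (fun k x' => W k (π x')) T'' hWπ hWπ' hβ₂ k (hT'' k))
    (fun k => cutDefect_of_localGauge blk π S W χX χX' G' G'' hW hW' hm₀ k (hIGc k)) (fun k => conjDefect₂_of_localGauge blk π S W hW hW' hm₂ k (hIT k))
    (fun k => commRowR_of_localGauge blk S W Δ hX G' hW hW' hθ k (hK' k)) (fun k => commRowR_of_localGauge (blk ∘ π) S (fun k x' => W k (π x')) Δ' hX' G'' hWπ hWπ' hθ k (hK'' k))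
    (fun k => commDefectR_of_localGauge blk π S W Δ Δ' hX hX' G' G'' hW hW' hr k (hDK k))
    (fun k => defectRow₂_of_localGauge blk S W E' hW hW' hε k (hEd' k)) (fun k => defectRow₂_of_localGauge (blk ∘ π) S (fun k x' => W k (π x')) E'' hWπ hWπ' hε k (hEd'' k))
    (fun k => conjDefect₂_of_localGauge blk π S W hW hW' hrE k (hDEd k)) hq

end Glue

end Summit.QuantumFields.YangMills.BalabanUVNodes.N15.Gluing

end
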